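import Summits.ValiantsHypothesis.ValiantsHypothesis.Theorems.BarrierLeverAnchoredDoorHitsLowerPairsStarExcessOne

/-!
# Route BarrierLever — support item `AnchoredDoorHitsLowerPairs` (stmt-ValiantsHypothesis-22510), line `anchored_peeling`:
# NODE TEXT «STAR-LOWER ON PAIRS OF EXCESS ≥ 2» — the residual of the door slot after the vertex-rich and excess-one theorems

Node file (`--supports stmt-ValiantsHypothesis-22510`; val-np-p1 g34). Closes NO item; nothing here bears on crux 14610 or on `VP ≠ VNP`, which is NOT
proved; `Stmt.conjStarLower` is NOT proved here.

With THEOREM A (`starDet_ne_zero_of_vertexRich`, …StarVertexRich: `r ≤ n₁ + n₂ + 1`) and THEOREM D (`starDet_ne_zero_of_excessOne`, …StarExcessOne: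
`r = n₁ + n₂ + 2`), STAR-LOWER is a theorem on every injective lower pair with `r ≤ n₁ + n₂ + 2` (`starDet_ne_zero_of_excess_le_one`). The node
`Stmt.conjStarLowerExcessTwo` below is STAR-LOWER on the remaining pairs (`r ≥ n₁ + n₂ + 3`, EXCESS `ε ≥ 2`): a 1:1 WEAKER replacement of the door slot
`Stmt.conjStarLower` and of `Stmt.conjStarLowerFaceRich` (…StarTwoCentre), with the kernel arrows `conjStarLowerFaceRich_of_excessTwo`,
`conjStarLower_of_excessTwo`, `anchoredDoorHitsLowerPairs_of_excessTwo`. CERTIFICATES AVAILABLE for it by name: two-centre 0/1 designs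
(`TCDesign.starDet_ne_zero_of_design`, …StarTwoCentreDesignDet) below the rank bound of …StarTwoCentreRefutation; the cube / compressed theorems
(…EvalCompressed) at the deep end. WHY IT MIGHT FAIL: as STAR-LOWER — one injective lower pair of excess ≥ 2 all of whose star-forest blocks are singular
(none known: census of record = every lower pair on ≤ 5+5 vertices, named pairs r ≤ 384, random pairs r ≤ 512).
-/

set_option linter.dupNamespace false

namespace Summit.ValiantsHypothesis.ValiantsHypothesis.Theorems.BarrierLever.AnchoredPeeling

open Finset

noncomputable section

/-- **NODE TEXT (val-np-p1 g34): STAR-LOWER ON PAIRS OF EXCESS `≥ 2`** (`r ≥ #{i : |u i| = 1} + #{j : |w j| = 1} + 3`). -/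
def Stmt.conjStarLowerExcessTwo : Prop :=
  ∀ (h r : ℕ) (u w : Fin r → Finset (Fin h)), Function.Injective u → Function.Injective w →
    IsLowerSet (Set.range u) → IsLowerSet (Set.range w) →
    (univ.filter fun i => (u i).card = 1).card + (univ.filter fun j => (w j).card = 1).card + 2 < r →
    ∃ g d : Fin h → Fin h → ℂ, (Matrix.of fun i j : Fin r => StarDoor.starEntry g d (u i) (w j)).det ≠ 0

/-- **ARROW:** excess `≥ 2` ⟹ face-rich (excess one is THEOREM D). -/
theorem conjStarLowerFaceRich_of_excessTwo (H : Stmt.conjStarLowerExcessTwo) : Stmt.conjStarLowerFaceRich := by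
  intro h r u w hu hw hlu hlw hface
  by_cases h2 : (univ.filter fun i => (u i).card = 1).card + (univ.filter fun j => (w j).card = 1).card + 2 < r
  · exact H h r u w hu hw hlu hlw h2
  · exact StarDoor.starDet_ne_zero_of_excessOne u w hu hw hlu hlw (by omega)

/-- **ARROW:** excess `≥ 2` ⟹ STAR-LOWER (vertex-rich = THEOREM A, excess one = THEOREM D). -/
theorem conjStarLower_of_excessTwo (H : Stmt.conjStarLowerExcessTwo) : Stmt.conjStarLower := by
  intro h r u w hu hw hlu hlw
  by_cases h2 : (univ.filter fun i => (u i).card = 1).card + (univ.filter fun j => (w j).card = 1).card + 2 < r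
  · exact H h r u w hu hw hlu hlw h2
  · exact StarDoor.starDet_ne_zero_of_excess_le_one u w hu hw hlu hlw (by omega)

/-- **… hence the item.** -/
theorem anchoredDoorHitsLowerPairs_of_excessTwo (H : Stmt.conjStarLowerExcessTwo) :
    Summit.ValiantsHypothesis.ValiantsHypothesis.Theses.BarrierLever.AnchoredDoorHitsLowerPairs :=
  anchoredDoorHitsLowerPairs_of_conjStarLower (conjStarLower_of_excessTwo H)

/-- **STAR-LOWER up to excess one, by name** (restating the unconditional range for the registry). -/
theorem conjStarLower_excess_le_one (h r : ℕ) (u w : Fin r → Finset (Fin h)) (hu : Function.Injective u) (hw : Function.Injective w)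
    (hlu : IsLowerSet (Set.range u)) (hlw : IsLowerSet (Set.range w))
    (hε : r ≤ (univ.filter fun i => (u i).card = 1).card + (univ.filter fun j => (w j).card = 1).card + 2) :
    ∃ g d : Fin h → Fin h → ℂ, (Matrix.of fun i j : Fin r => StarDoor.starEntry g d (u i) (w j)).det ≠ 0 :=
  StarDoor.starDet_ne_zero_of_excess_le_one u w hu hw hlu hlw hε

end

end Summit.ValiantsHypothesis.ValiantsHypothesis.Theorems.BarrierLever.AnchoredPeeling
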